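import Summits.AnomalousDissipation.AnomalousDissipation.Theorems.QuarticGate.Negative.Laminar

/-!
# Negative knowledge for the crux `MomentParity.ResolvedDissipation` (stmt-AnomalousDissipation-14284):
# I — vocabulary and the shear-mode family `K_{M,a} = a cos(2πM x₁) e₀`

Certified copy of §0–§1 of the cdisprove work file `Cruxes/ResolvedDissipation/Disproof.lean`
(refuter-cdisprove-stmt-AnomalousDissipation-14284-0, cycle 1). Supports stmt-AnomalousDissipation-14284; no
positive route-item statement is asserted.

* `resolvedDissipation_iff` — the crux ↔ its clauses named (`IsLevel`, `IsBandTest`, `polyGrad` of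
  `QuarticGate/Negative/LevelCeiling`, plus `IsStationary` (all orders), `IsResolved`), by `Iff.rfl`.
* `shearField M a` — the parallel shear mode at frequency `M e₁` (amplitude `a`, direction `e₀`): smooth,
  solenoidal, mean-zero, `Δ K = −4π²M² K`, `(K·∇)K = 0`; an exact steady state of NS (hence of every Galerkin
  truncation containing it) at force `4π²νM² K_{M,a}` (`nsGeneratorPairing_shearField`), of Euler at zero force
  (`nsGeneratorPairing_shearField_euler`), and INVISIBLE at zero force to every smooth test without the modes
  `±M e₁` (`nsGeneratorPairing_shearField_of_coeff_eq_zero`).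
* `shearState M hM a ∈ H` — its class: level `N` for `N ≥ M`, `‖·‖² = a²/2`, enstrophy `2π²M²a²` (all on the
  shell `M`), truncated enstrophy `0` below the shell (`eGradNormSq_fourierTruncate_shearState`).
-/

noncomputable section

-- `Summit.<Summit>.<Problem>` is the tree's mandated summit-side namespace (CONVENTIONS §2); for this
-- single-conjunct summit the two segments coincide, so the duplicate is deliberate.
set_option linter.dupNamespace false

namespace Summit.AnomalousDissipation.AnomalousDissipation.Theorems.ResolvedDissipation.Negative

open MeasureTheory Filter Topology
open scoped ENNReal InnerProductSpace RealInnerProductSpace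
open Literature.Analysis.FunctionSpaces Literature.Analysis.FluidPDE
open Summit.AnomalousDissipation.AnomalousDissipation.Theses.MomentParity
open Summit.AnomalousDissipation.AnomalousDissipation.Theorems.QuarticGate.Negative

/-- The 3-torus. -/
abbrev T3 : Type := UnitAddTorus (Fin 3)
/-- Velocity values. -/
abbrev R3 : Type := EuclideanSpace ℝ (Fin 3)
/-- The energy space `H = L²_σ(T³)` of the crux. -/
abbrev H3 : Type := ↥(Torus.energySpace (Fin 3))

/-- Local notation for the real Hilbert space `L²(T³; ℝ³)`. -/
local notation "L2T3" => Lp (EuclideanSpace ℝ (Fin 3)) 2 (volume : Measure (UnitAddTorus (Fin 3)))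

/-! ## Vocabulary (verbatim clauses of `ResolvedDissipation`, named; `IsLevel`/`IsBandTest`/`polyGrad` from `LevelCeiling`) -/

/-- Stationarity at EVERY order for Galerkin NS at `(ν, f)` and level `N`: all polynomial cylindrical
observables with level-`N` band tests are drift-free (row integrable and `0`) — the crux's hypothesis
(no degree bound, unlike `IsPolyStationary ν f N d`). [folklore] -/
def IsStationary (ν : ℝ) (f : T3 → R3) (N : ℕ) (μ : Measure H3) : Prop :=
  ∀ (m : ℕ) (g : Fin m → T3 → R3) (P : MvPolynomial (Fin m) ℝ), (∀ i, IsBandTest N (g i)) →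
    Integrable (fun u => Torus.nsGeneratorPairing ν f u (polyGrad g P u)) μ ∧
      ∫ u, Torus.nsGeneratorPairing ν f u (polyGrad g P u) ∂μ = 0

/-- `κ`-resolution of the mean enstrophy of `μ` at tolerance `1/(n+1)`:
`∫ ‖∇u‖² dμ ≤ ∫ ‖∇P_{κ n} u‖² dμ + (n+1)⁻¹` — the crux's conclusion. [folklore] -/
def IsResolved (κ : ℕ → ℕ) (μ : Measure H3) (n : ℕ) : Prop :=
  ∫⁻ u : H3, Torus.eGradNormSq (u.1 : T3 → R3) ∂μ ≤
    (∫⁻ u : H3, Torus.eGradNormSq (Torus.fourierTruncate (κ n) (u.1 : T3 → R3)) ∂μ) +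
      ((n : ℝ≥0∞) + 1)⁻¹

/-- `ResolvedDissipation` restated through the vocabulary (definitional unfolding, `Iff.rfl`):
`∀ f ν R, ∃ κ, ∀ N μ` — ONE schedule for all levels and all invariant laws in the ball. [folklore] -/
theorem resolvedDissipation_iff :
    ResolvedDissipation ↔ ∀ f : T3 → R3, Torus.IsSmooth f → Torus.IsDivFree f → Torus.HasZeroMean f →
      ∀ ν : ℝ, 0 < ν → ∀ R : ℝ, ∃ κ : ℕ → ℕ, ∀ (N : ℕ) (μ : Measure H3), IsProbabilityMeasure μ →
        (∀ᵐ u ∂μ, IsLevel N u) → (∀ᵐ u ∂μ, ‖u‖ ≤ R) → IsStationary ν f N μ → ∀ n, IsResolved κ μ n :=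
  Iff.rfl

/-! ## §1 The shear mode at frequency `M`: `K_{M,a}(x) = a cos(2πM x₁) e₀`

An exact steady state of Galerkin NS at every truncation containing it (force `4π²νM² K_{M,a}`), of Euler
(`ν = 0`, any force-free truncation), with ALL its enstrophy `2π²M²a²` on the shell `|k| = M` and energy
`a²/2` independent of `M`. -/

/-- The frequency `M e₁ = (0, M, 0)`. [folklore] -/
def shearFreq (M : ℕ) : Fin 3 → ℤ := Pi.single 1 (M : ℤ)

/-- The symmetric pair `{M e₁, −M e₁}`. [folklore] -/
def shearSet (M : ℕ) : Finset (Fin 3 → ℤ) := {shearFreq M, -shearFreq M}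

/-- The shear mode `K_{M,a}(x) = a cos(2πM x₁) e₀` (coefficients `(a/2) e₀` = `kolCoeff a` on `{±M e₁}`). [folklore] -/
def shearField (M : ℕ) (a : ℝ) : T3 → R3 := Torus.realTrigPoly (shearSet M) (kolCoeff a)

/-- `shearFreq_apply_zero` (bookkeeping for the shear-mode family). [folklore] -/
theorem shearFreq_apply_zero (M : ℕ) : shearFreq M 0 = 0 := by simp [shearFreq]

/-- `shearFreq_apply_one` (bookkeeping for the shear-mode family). [folklore] -/
theorem shearFreq_apply_one (M : ℕ) : shearFreq M 1 = M := by simp [shearFreq]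

/-- `shearFreq_ne_zero` (bookkeeping for the shear-mode family). [folklore] -/
theorem shearFreq_ne_zero {M : ℕ} (hM : M ≠ 0) : shearFreq M ≠ 0 := fun h => by
  have := congrFun h 1
  simp [shearFreq] at this
  exact hM this

/-- `freqNormSq_shearFreq` (bookkeeping for the shear-mode family). [folklore] -/
theorem freqNormSq_shearFreq (M : ℕ) : Torus.freqNormSq (shearFreq M) = (M : ℝ) ^ 2 := by
  simp [Torus.freqNormSq, shearFreq, Fin.sum_univ_three]

/-- `neg_mem_shearSet` (bookkeeping for the shear-mode family). [folklore] -/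
theorem neg_mem_shearSet (M : ℕ) : ∀ k ∈ shearSet M, -k ∈ shearSet M := by
  intro k hk
  simp only [shearSet, Finset.mem_insert, Finset.mem_singleton] at hk ⊢
  rcases hk with rfl | rfl <;> simp

/-- `freqNormSq_of_mem_shearSet` (bookkeeping for the shear-mode family). [folklore] -/
theorem freqNormSq_of_mem_shearSet {M : ℕ} {k : Fin 3 → ℤ} (hk : k ∈ shearSet M) :
    Torus.freqNormSq k = (M : ℝ) ^ 2 := by
  simp only [shearSet, Finset.mem_insert, Finset.mem_singleton] at hk
  rcases hk with rfl | rfl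
  · exact freqNormSq_shearFreq M
  · rw [Torus.freqNormSq_neg]; exact freqNormSq_shearFreq M

/-- `ne_zero_of_mem_shearSet` (bookkeeping for the shear-mode family). [folklore] -/
theorem ne_zero_of_mem_shearSet {M : ℕ} (hM : M ≠ 0) {k : Fin 3 → ℤ} (hk : k ∈ shearSet M) : k ≠ 0 := by
  intro h; subst h
  have h1 := freqNormSq_of_mem_shearSet hk
  rw [Torus.freqNormSq_zero] at h1
  have : (M : ℝ) ≠ 0 := by exact_mod_cast hM
  exact this (pow_eq_zero_iff two_ne_zero |>.1 h1.symm)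

/-- `apply_zero_of_mem_shearSet` (bookkeeping for the shear-mode family). [folklore] -/
theorem apply_zero_of_mem_shearSet {M : ℕ} {k : Fin 3 → ℤ} (hk : k ∈ shearSet M) : k 0 = 0 := by
  simp only [shearSet, Finset.mem_insert, Finset.mem_singleton] at hk
  rcases hk with rfl | rfl <;> simp [shearFreq]

/-- `isTransversal_kolCoeff_shearSet` (bookkeeping for the shear-mode family). [folklore] -/
theorem isTransversal_kolCoeff_shearSet (M : ℕ) (a : ℝ) : Torus.IsTransversal (shearSet M) (kolCoeff a) := by
  intro k hk
  simp [kolCoeff, EuclideanSpace.complexify_apply, Fin.sum_univ_three, apply_zero_of_mem_shearSet hk]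

/-- `K_{M,a}` is smooth. [folklore] -/
theorem isSmooth_shearField (M : ℕ) (a : ℝ) : Torus.IsSmooth (shearField M a) :=
  Torus.isSmooth_realTrigPoly _ _

/-- `K_{M,a}` is divergence free. [folklore] -/
theorem isDivFree_shearField (M : ℕ) (a : ℝ) : Torus.IsDivFree (shearField M a) :=
  Torus.isDivFree_realTrigPoly (isTransversal_kolCoeff_shearSet M a)

/-- `K_{M,a}` has zero mean (`M ≠ 0`). [folklore] -/
theorem hasZeroMean_shearField {M : ℕ} (hM : M ≠ 0) (a : ℝ) : Torus.HasZeroMean (shearField M a) := by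
  unfold Torus.HasZeroMean shearField
  simp_rw [Torus.realTrigPoly_apply_eq_sum]
  rw [integral_finsetSum _ fun k _ => ?_]
  · refine Finset.sum_eq_zero fun k hk => ?_
    have hi : Integrable (fun x : UnitAddTorus (Fin 3) => UnitAddTorus.mFourier k x • kolCoeff a k) volume :=
      ((UnitAddTorus.mFourier k).continuous.smul continuous_const).integrable_unitAddTorus
    rw [ContinuousLinearMap.integral_comp_comm _ hi, integral_smul_const, Torus.integral_mFourier,
      if_neg (ne_zero_of_mem_shearSet hM hk), zero_smul, map_zero]
  · exact (EuclideanSpace.realPart.continuous.comp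
      ((UnitAddTorus.mFourier k).continuous.smul continuous_const)).integrable_unitAddTorus

/-- `K_{M,ra} = r K_{M,a}`. [folklore] -/
theorem shearField_mul (M : ℕ) (r a : ℝ) (x : T3) : shearField M (r * a) x = r • shearField M a x := by
  simp only [shearField, Torus.realTrigPoly_apply_eq_sum, kolCoeff_mul, Finset.smul_sum]
  refine Finset.sum_congr rfl fun k _ => ?_
  rw [← map_smul, smul_comm, Complex.coe_smul]

/-- `K_{M,0} = 0`. [folklore] -/
theorem shearField_zero (M : ℕ) : shearField M 0 = 0 := by
  have h : kolCoeff 0 = 0 := by funext k; simp [kolCoeff]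
  rw [shearField, h, Torus.realTrigPoly_zero]

/-- `ΔK_{M,a} = −4π²M² K_{M,a}`. [folklore] -/
theorem laplacian_shearField (M : ℕ) (a : ℝ) (x : T3) :
    Torus.laplacian (shearField M a) x = -(4 * Real.pi ^ 2 * (M : ℝ) ^ 2) • shearField M a x := by
  rw [shearField, Torus.laplacian_realTrigPoly, show -(4 * Real.pi ^ 2 * (M : ℝ) ^ 2) •
    Torus.realTrigPoly (shearSet M) (kolCoeff a) x = shearField M (-(4 * Real.pi ^ 2 * (M : ℝ) ^ 2) * a) x
    from (shearField_mul M _ _ x).symm, shearField]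
  refine congrFun (Torus.realTrigPoly_congr fun k hk => ?_) x
  rw [kolCoeff_mul, freqNormSq_of_mem_shearSet hk]
  simp

/-- `∂₀ K_{M,a} = 0`. [folklore] -/
theorem partialDeriv_zero_shearField (M : ℕ) (a : ℝ) : Torus.partialDeriv 0 (shearField M a) = 0 := by
  rw [shearField, Torus.partialDeriv_realTrigPoly', ← Torus.realTrigPoly_zero (shearSet M)]
  refine Torus.realTrigPoly_congr fun k hk => ?_
  simp [apply_zero_of_mem_shearSet hk]

/-- The components `i ≠ 0` of `K_{M,a}` vanish. [folklore] -/
theorem shearField_apply_of_ne (M : ℕ) (a : ℝ) (x : T3) {i : Fin 3} (hi : i ≠ 0) :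
    shearField M a x i = 0 := by
  rw [shearField, Torus.realTrigPoly_apply_coord, Torus.trigPoly_apply]
  simp [kolCoeff, EuclideanSpace.complexify_apply, hi.symm]

/-- `(K·∇)K = 0`: a parallel shear mode has no self-advection. [folklore] -/
theorem convect_shearField_self (M : ℕ) (a : ℝ) (x : T3) :
    Torus.convect (shearField M a) (shearField M a) x = 0 := by
  rw [Torus.convect, Torus.fderiv_apply_eq_sum_partialDeriv ((isSmooth_shearField M a).isContDiff (by simp))]
  refine Finset.sum_eq_zero fun i _ => ?_
  by_cases hi : i = 0
  · subst hi; rw [partialDeriv_zero_shearField]; simp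
  · rw [shearField_apply_of_ne M a x hi, zero_smul]

/-- The transport term of a shear mode vanishes against every smooth field: `∫ ⟪K, (K·∇)w⟫ = 0`
(`= −∫ ⟪(K·∇)K, w⟫ = 0`). [folklore] -/
theorem integral_inner_convect_shearField (M : ℕ) (a : ℝ) {w : T3 → R3} (hw : Torus.IsSmooth w) :
    ∫ x, ⟪shearField M a x, Torus.convect (shearField M a) w x⟫_ℝ = 0 := by
  have hK := isSmooth_shearField M a
  have h := Torus.integral_inner_convect_add_eq_zero hK (isDivFree_shearField M a) hK hw
  have h0 : ∫ x, ⟪Torus.convect (shearField M a) (shearField M a) x, w x⟫_ℝ = 0 := by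
    simp_rw [convect_shearField_self, inner_zero_left, integral_zero]
  linarith

/-- `∫ ⟪K_{M,a}, Δw⟫ = −4π²M² ∫ ⟪K_{M,a}, w⟫` for smooth `w`. [folklore] -/
theorem integral_inner_laplacian_shearField (M : ℕ) (a : ℝ) {w : T3 → R3} (hw : Torus.IsSmooth w) :
    ∫ x, ⟪shearField M a x, Torus.laplacian w x⟫_ℝ =
      -(4 * Real.pi ^ 2 * (M : ℝ) ^ 2) * ∫ x, ⟪shearField M a x, w x⟫_ℝ := by
  rw [← Torus.integral_inner_laplacian_comm (isSmooth_shearField M a) hw]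
  simp_rw [laplacian_shearField, inner_smul_left]
  rw [integral_const_mul]
  simp

/-- **`K_{M,a}` is an exact steady state of (Galerkin) NS at force `4π²νM² K_{M,a}`**: `⟨F(U), w⟩ = 0`
for EVERY smooth `w` (so for every truncation's tests), `U` the class of `K_{M,a}`. [folklore] -/
theorem nsGeneratorPairing_shearField {M : ℕ} {ν a : ℝ} {U : H3}
    (hU : ((U.1 : L2T3) : T3 → R3) =ᵐ[volume] shearField M a) {w : T3 → R3} (hw : Torus.IsSmooth w) :
    Torus.nsGeneratorPairing ν (shearField M (4 * Real.pi ^ 2 * ν * (M : ℝ) ^ 2 * a)) U w = 0 := by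
  have hK := isSmooth_shearField M a
  have hf := isSmooth_shearField M (4 * Real.pi ^ 2 * ν * (M : ℝ) ^ 2 * a)
  rw [Torus.nsGeneratorPairing_eq_flux ν (hf.memLp 2) hw hU]
  have hi1 : Integrable (fun x => ⟪shearField M a x, Torus.convect (shearField M a) w x⟫_ℝ) volume :=
    (hK.continuous.inner (hK.convect hw).continuous).integrable_unitAddTorus
  have hi2 : Integrable (fun x => ν * ⟪shearField M a x, Torus.laplacian w x⟫_ℝ) volume :=
    ((hK.continuous.inner hw.laplacian.continuous).integrable_unitAddTorus).const_mul ν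
  have hi3 : Integrable (fun x => ⟪shearField M (4 * Real.pi ^ 2 * ν * (M : ℝ) ^ 2 * a) x, w x⟫_ℝ) volume :=
    (hf.continuous.inner hw.continuous).integrable_unitAddTorus
  have hi12 : Integrable (fun x => ⟪shearField M a x, Torus.convect (shearField M a) w x⟫_ℝ +
      ν * ⟪shearField M a x, Torus.laplacian w x⟫_ℝ) volume := hi1.add hi2
  rw [integral_add hi12 hi3, integral_add hi1 hi2, integral_const_mul,
    integral_inner_convect_shearField M a hw, integral_inner_laplacian_shearField M a hw]
  have h3 : ∫ x, ⟪shearField M (4 * Real.pi ^ 2 * ν * (M : ℝ) ^ 2 * a) x, w x⟫_ℝ =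
      (4 * Real.pi ^ 2 * ν * (M : ℝ) ^ 2) * ∫ x, ⟪shearField M a x, w x⟫_ℝ := by
    simp_rw [shearField_mul, inner_smul_left]
    rw [integral_const_mul]
    simp
  rw [h3]
  ring

/-- **Free shear modes are steady for Euler**: at `ν = 0` and zero force, `⟨F(U), w⟩ = 0` for every
smooth `w` (the class `U` of ANY `K_{M,a}`). [folklore] -/
theorem nsGeneratorPairing_shearField_euler {M : ℕ} {a : ℝ} {U : H3}
    (hU : ((U.1 : L2T3) : T3 → R3) =ᵐ[volume] shearField M a) {w : T3 → R3} (hw : Torus.IsSmooth w) :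
    Torus.nsGeneratorPairing 0 (0 : T3 → R3) U w = 0 := by
  have h := nsGeneratorPairing_shearField (ν := 0) hU hw
  simpa [shearField_zero] using h

/-- **A decaying shear mode is invisible below its shell**: at zero force and ANY viscosity,
`⟨F(U), w⟩ = ν (K_{M,a}, Δw) = −4π²M²ν (K_{M,a}, w) = 0` for every smooth `w` without the modes `±M e₁`. [folklore] -/
theorem nsGeneratorPairing_shearField_of_coeff_eq_zero {M : ℕ} {ν a : ℝ} {U : H3}
    (hU : ((U.1 : L2T3) : T3 → R3) =ᵐ[volume] shearField M a) {w : T3 → R3} (hw : Torus.IsSmooth w)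
    (hw0 : ∀ k ∈ shearSet M, UnitAddTorus.mFourierCoeff (EuclideanSpace.complexify ∘ w) k = 0) :
    Torus.nsGeneratorPairing ν (0 : T3 → R3) U w = 0 := by
  have hK := isSmooth_shearField M a
  have hf0 : MemLp (0 : T3 → R3) 2 volume := (Torus.isSmooth_const (0 : R3)).memLp 2
  rw [Torus.nsGeneratorPairing_eq_flux ν hf0 hw hU]
  have hi1 : Integrable (fun x => ⟪shearField M a x, Torus.convect (shearField M a) w x⟫_ℝ) volume :=
    (hK.continuous.inner (hK.convect hw).continuous).integrable_unitAddTorus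
  have hi2 : Integrable (fun x => ν * ⟪shearField M a x, Torus.laplacian w x⟫_ℝ) volume :=
    ((hK.continuous.inner hw.laplacian.continuous).integrable_unitAddTorus).const_mul ν
  have hi3 : Integrable (fun x => ⟪(0 : T3 → R3) x, w x⟫_ℝ) volume := by simp
  have hi12 : Integrable (fun x => ⟪shearField M a x, Torus.convect (shearField M a) w x⟫_ℝ +
      ν * ⟪shearField M a x, Torus.laplacian w x⟫_ℝ) volume := hi1.add hi2
  rw [integral_add hi12 hi3, integral_add hi1 hi2, integral_const_mul,
    integral_inner_convect_shearField M a hw, integral_inner_laplacian_shearField M a hw,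
    shearField, Torus.integral_inner_realTrigPoly_left (neg_mem_shearSet M) (isConjSymm_kolCoeff a)
      (hw.memLp 2), Finset.sum_eq_zero fun k hk => by rw [hw0 k hk, inner_zero_right, Complex.zero_re]]
  simp

/-- `shearFreq M ≠ -shearFreq M` (`M ≠ 0`). [folklore] -/
theorem shearFreq_ne_neg {M : ℕ} (hM : M ≠ 0) : shearFreq M ≠ -shearFreq M := fun h => by
  have := congrFun h 1
  simp [shearFreq] at this
  omega

/-- `card_shearSet` (bookkeeping for the shear-mode family). [folklore] -/
theorem card_shearSet {M : ℕ} (hM : M ≠ 0) : (shearSet M).card = 2 := by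
  rw [shearSet, Finset.card_insert_of_notMem (by simpa using shearFreq_ne_neg hM), Finset.card_singleton]

/-- `‖∇K_{M,a}‖² = 2π²M²a²` (all of it on the shell `|k| = M`), in `ℝ≥0∞`. [folklore] -/
theorem eGradNormSq_shearField {M : ℕ} (hM : M ≠ 0) (a : ℝ) :
    Torus.eGradNormSq (shearField M a) = ENNReal.ofReal (2 * Real.pi ^ 2 * (M : ℝ) ^ 2 * a ^ 2) := by
  rw [shearField, Torus.eGradNormSq_realTrigPoly (neg_mem_shearSet M) (isConjSymm_kolCoeff a),
    Finset.sum_congr rfl fun k hk => by rw [freqNormSq_of_mem_shearSet hk, norm_kolCoeff],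
    Finset.sum_const, card_shearSet hM]
  congr 1
  simp only [nsmul_eq_mul, Nat.cast_ofNat, div_pow, sq_abs]
  ring

/-- `∫ ‖K_{M,a}‖² = a²/2` (independent of `M`). [folklore] -/
theorem integral_norm_sq_shearField {M : ℕ} (hM : M ≠ 0) (a : ℝ) : ∫ x, ‖shearField M a x‖ ^ 2 = a ^ 2 / 2 := by
  rw [shearField, Torus.integral_norm_sq_realTrigPoly (neg_mem_shearSet M) (isConjSymm_kolCoeff a),
    Finset.sum_congr rfl fun k _ => by rw [norm_kolCoeff], Finset.sum_const, card_shearSet hM]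
  simp only [nsmul_eq_mul, Nat.cast_ofNat, div_pow, sq_abs]
  ring

/-- Fourier coefficients of `K_{M,a}` vanish off `{±M e₁}`. [folklore] -/
theorem mFourierCoeff_shearField_eq_zero {M : ℕ} (a : ℝ) {k : Fin 3 → ℤ} (hk : k ∉ shearSet M) :
    UnitAddTorus.mFourierCoeff (EuclideanSpace.complexify ∘ shearField M a) k = 0 :=
  Torus.mFourierCoeff_realTrigPoly_eq_zero (neg_mem_shearSet M) (isConjSymm_kolCoeff a) hk

/-- **Below the shell the truncation sees nothing**: `P_K K_{M,a} = 0` for `K < M`. [folklore] -/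
theorem fourierTruncate_shearField {K M : ℕ} (hKM : K < M) (a : ℝ) :
    Torus.fourierTruncate K (shearField M a) = 0 := by
  rw [Torus.fourierTruncate, ← Torus.realTrigPoly_zero (Torus.freqBall K)]
  refine Torus.realTrigPoly_congr fun k hk => ?_
  refine mFourierCoeff_shearField_eq_zero a fun hkS => ?_
  have h1 : Torus.freqNormSq k ≤ (K : ℝ) ^ 2 := Torus.mem_freqBall.1 hk
  rw [freqNormSq_of_mem_shearSet hkS] at h1
  have h2 : (K : ℝ) < M := by exact_mod_cast hKM
  nlinarith [h2, (Nat.cast_nonneg K : (0 : ℝ) ≤ K)]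

/-- The spectral enstrophy of the zero field is `0`. [folklore] -/
theorem eGradNormSq_zero : Torus.eGradNormSq (0 : T3 → R3) = 0 := by
  rw [← Torus.realTrigPoly_zero (∅ : Finset (Fin 3 → ℤ)),
    Torus.eGradNormSq_realTrigPoly (by simp) Torus.isConjSymm_zero]
  simp

/-- Truncation only sees the a.e. class. [folklore] -/
theorem fourierTruncate_congr_ae {v w : T3 → R3} (h : v =ᵐ[volume] w) (K : ℕ) :
    Torus.fourierTruncate K v = Torus.fourierTruncate K w := by
  rw [Torus.fourierTruncate, Torus.fourierTruncate]
  congr 1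
  funext k
  exact mFourierCoeff_congr_ae h k

/-- The class of `K_{M,a}` in `H`. [folklore] -/
def shearState (M : ℕ) (hM : M ≠ 0) (a : ℝ) : H3 :=
  ⟨((isSmooth_shearField M a).memLp 2).toLp (shearField M a),
    Torus.smoothSolenoidal_subset_energySpace ⟨shearField M a, isSmooth_shearField M a,
      isDivFree_shearField M a, hasZeroMean_shearField hM a, MemLp.coeFn_toLp _⟩⟩

/-- `coe_shearState_ae` (bookkeeping for the shear-mode family). [folklore] -/
theorem coe_shearState_ae {M : ℕ} (hM : M ≠ 0) (a : ℝ) :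
    (((shearState M hM a).1 : L2T3) : T3 → R3) =ᵐ[volume] shearField M a :=
  MemLp.coeFn_toLp ((isSmooth_shearField M a).memLp 2)

/-- `K_{M,a}` is a level-`N` field for every `N ≥ M`. [folklore] -/
theorem isLevel_shearState {M : ℕ} (hM : M ≠ 0) (a : ℝ) {N : ℕ} (hMN : M ≤ N) :
    IsLevel N (shearState M hM a) := by
  intro k hk
  rw [mFourierCoeff_congr_ae (coe_shearState_ae hM a)]
  refine mFourierCoeff_shearField_eq_zero a fun hkS => hk (Finset.mem_erase.2 ⟨ne_zero_of_mem_shearSet hM hkS,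
    Torus.mem_freqBall.2 ?_⟩)
  rw [freqNormSq_of_mem_shearSet hkS]
  have : (M : ℝ) ≤ N := by exact_mod_cast hMN
  nlinarith

/-- `‖[K_{M,a}]‖²_H = a²/2`. [folklore] -/
theorem norm_sq_shearState {M : ℕ} (hM : M ≠ 0) (a : ℝ) : ‖shearState M hM a‖ ^ 2 = a ^ 2 / 2 := by
  have h : ‖shearState M hM a‖ = ‖((shearState M hM a).1 : L2T3)‖ := rfl
  rw [h, ← Torus.integral_norm_sq_coe_eq, ← integral_norm_sq_shearField hM a]
  exact integral_congr_ae ((coe_shearState_ae hM a).mono fun x hx => by simp [hx])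

/-- `‖[K_{M,1}]‖_H ≤ 1`. [folklore] -/
theorem norm_shearState_one_le {M : ℕ} (hM : M ≠ 0) : ‖shearState M hM 1‖ ≤ 1 := by
  have h := norm_sq_shearState hM 1
  nlinarith [norm_nonneg (shearState M hM 1)]

/-- Enstrophy of the class: `‖∇[K_{M,a}]‖² = 2π²M²a²`. [folklore] -/
theorem eGradNormSq_shearState {M : ℕ} (hM : M ≠ 0) (a : ℝ) :
    Torus.eGradNormSq (((shearState M hM a).1 : L2T3) : T3 → R3) =
      ENNReal.ofReal (2 * Real.pi ^ 2 * (M : ℝ) ^ 2 * a ^ 2) := by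
  rw [eGradNormSq_congr_ae (coe_shearState_ae hM a), eGradNormSq_shearField hM]

/-- Below the shell, the truncated enstrophy of the class vanishes. [folklore] -/
theorem eGradNormSq_fourierTruncate_shearState {K M : ℕ} (hM : M ≠ 0) (hKM : K < M) (a : ℝ) :
    Torus.eGradNormSq (Torus.fourierTruncate K (((shearState M hM a).1 : L2T3) : T3 → R3)) = 0 := by
  rw [fourierTruncate_congr_ae (coe_shearState_ae hM a), fourierTruncate_shearField hKM, eGradNormSq_zero]



end Summit.AnomalousDissipation.AnomalousDissipation.Theorems.ResolvedDissipation.Negative
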